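import Summits.ResolutionOfSingularities.ResolutionOfSingularities.Theorems.HilbertSamuelEliminationCampaignW42TertiaryCompactness
import Summits.ResolutionOfSingularities.ResolutionOfSingularities.Theorems.HilbertSamuelEliminationSigmaMaxModificationsCorridor3RegularCentresPermissible
import Summits.ResolutionOfSingularities.ResolutionOfSingularities.Theorems.HilbertSamuelEliminationSigmaMaxModificationsCorridor3TameWildNuModPackaging
import HarnessLib

/-!
# [OURS · L1 W4.2] What the O2 statement buys: `TertiaryTermination p` makes the canonical sequence `S(X, ν)` a
# `ν`-elimination at every isolated maximal stratum, hence a `ν`-modification (calibration against Corridor3,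
# stmt-ResolutionOfSingularities-19249, and the crux stmt-…-18506; `--supports stmt-ResolutionOfSingularities-17846`)

OURS (slot W4.2 of cell res-hironaka, LADDER-RESOLUTION rung L, D-0089; prover seat res-L1-s42-pv-2, gen 2); NOT
statements of H. Hironaka's manuscript [Hironaka2017]; nothing of the manuscript is used or asserted. AI review is
weaker than expert review. Pure PROOF file over the OURS statement file `…CampaignW42Tertiary.lean` (p471660/p474474,
OURS-DESK #39, lanes A/B 21·21) and its sorry-free companions (Reduction p475287, Genuine p476789, States p477843,
Compactness p478155): no new definition is introduced — every extra hypothesis is spelled inline.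

## What is proved

Write `S = S(X, ν)` for the canonical `ν`-elimination sequence of CJS Rem. 6.29 (1) as the tree renders it
(`IsCanonicalRun R N ν`, oracle `R` for the lower-dimensional resolution sequences), at an ISOLATED ORIGIN
`X(ν) = {x}` (`IsIsolatedOrigin p N ν X x`).

1. THE LIVENESS DICHOTOMY (any oracle): `S` TERMINATES (tree `CanonicalSequenceTerminates`: some canonical run ends
   with `X_n(ν) = ∅`), or is INFINITE (tree `CanonicalSequenceInfinite`: runs of every length), or is STUCK (a
   canonical run with `X_n(ν) ≠ ∅` that no canonical run prolongs — the oracle has no answer, or the replayed strict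
   transform does not embed): `canonicalSequence_trichotomy`; hence LIVE ∧ ¬INFINITE ⇒ TERMINATES
   (`canonicalSequenceTerminates_of_live_of_not_infinite`). «Live» is the inline hypothesis
   `∀ s, s.IsCanonicalRun R N ν → (X_s(ν)).Nonempty → ∃ s', s'.IsCanonicalRun R N ν ∧ s'.length = s.length + 1`.
2. CLOSING THE BRACKET of the Reduction/Compactness files: at an isolated origin, for a functional oracle whose
   canonical centres are permissible (CJS Lemma 5.34 (3) in the source's setting) and which is live along `S`,
   `NoNearChainFrom R N ν (MarkedStage.init X x) ⊤ ↔ CanonicalSequenceTerminates R N ν X`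
   (`noNearChain_init_iff_canonicalSequenceTerminates`): the ungraded O2 statement at `(X, x)` IS «this procedure
   ends» (CJS Rem. 6.29 (1)) for `S(X, ν)`. In particular `TertiaryTermination p` gives termination of `S(X, ν)` at
   every isolated origin of characteristic `p` (`canonicalSequenceTerminates_of_tertiaryTermination`).
3. THE TERMINATING RUN IS A `ν`-ELIMINATION (CJS Def. 6.14, tree `CentreSeq.IsNuElimination`) as soon as the canonical
   centres are permissible and lie in the successive `ν`-strata (`exists_isNuElimination_of_canonicalSequenceTerminates`);
   for a reduced excellent `X` with `dim X ≤ N` and `ν ≠ Φ^{(N)}` it suffices that they are REGULAR and lie in the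
   strata (tree, res-L1-w42-stub-3: `CentreSeq.allPermissible_of_allRegular_of_centresInStratum`, CJS Thm. 3.3) — the
   content of CJS p. 92 «Y_{0,i} = Y_i^{(0)}» with Rem. 6.29 (1) «which are also permissible … by Lemma 5.34 (3)».
4. HENCE A `ν`-MODIFICATION (line tame_wild's `TameWild.NuMod`, CJS Def. 6.14 in modification form, via the landed
   packaging `TameWild.nuMod_of_isNuElimination`, p460155): `nuMod_of_tertiaryTermination` — for every prime-power-free
   datum: `X` reduced, separated (not needed), of finite type over a field `k` of characteristic `p`, `dim X ≤ d`,
   `dim X ≤ N`, `ν` maximal in `Σ_X(N)`, `X(ν) = {x}` with `x` closed, canonical centres regular in the strata, `S`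
   live: `TertiaryTermination p → NuMod X N d ν`. This is the ISOLATED-POINT case of what the confined open core of
   line tame_wild («stub_confinedWildNu3»: «the engine wanted is a termination argument at finitely many closed points
   with `e_x = 3`», CRUX-PLAN v2 §4) asks for, in EVERY dimension (so also for `SigmaMaxModificationsDimGe4`,
   stmt-…-19250), with the typed O2 open item (`TertiaryInvariantLaxExists p 3` & co.) as its one research input.
5. THE EXISTENTIAL-ORACLE COROLLARY (answer to lane B's note (b) on desk #39, res-ref-b4 00:48:40Z: the OURS
   statements quantify over ALL admissible functional oracles, which is stronger than the crux): for the `⇒ NuMod`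
   direction ONE live admissible functional oracle without infinite near chains suffices
   (`nuMod_of_noNearChain`), so an adversarial-oracle refutation of `TertiaryTermination p` would not touch this use.

## What is NOT proved (carried as inline hypotheses, exactly as in the Compactness file)

* LIVENESS of `S(X, ν)` for the intended oracle: needs the oracle's answers on the reduced parts `Y_n^{(j)}` (the
  lower-dimensional canonical resolution sequences — induction on dimension) and the closed immersion of the replayed
  strict transform (GW Prop. 13.96 (2), tree named fact `StrictTransformClosedImmersion`).
* REGULARITY / IN-STRATUM of the canonical centres («Y_{0,i} = Y_i^{(0)}», CJS p. 92, Lemma 5.34 (3)): a theorem of the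
  source's two-dimensional setting, not built into the tree's step relation (see `CanonicalEliminationSequence.lean`,
  «What is NOT built in»).
* O2 itself: `TertiaryTermination p` / `TertiaryInvariantLaxExists p 3` — OPEN (CJS §1.3 p. 4).

## References

* V. Cossart, U. Jannsen, S. Saito, *Desingularization: Invariants and Strategy*, LNM 2270 (2020): Rem. 6.29 (1)
  pp. 91–92, p. 92, p. 107, Def. 6.14, Thm. 3.3, Lemma 5.34 (3), §1.3 p. 4. [CossartJannsenSaito2020]
* U. Görtz, T. Wedhorn, *Algebraic Geometry I* (2nd ed. 2020), Prop. 13.96 (2). [GortzWedhorn2020]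
* route file Theses/HilbertSamuelElimination.lean (items 17846, 19249, 19250, 18506); L/w42/CRUX-PLAN-v2.md §4;
  L/res-L1-w42-lead-1/tame_wild_current.lean (skeleton v3).
-/

noncomputable section

set_option linter.dupNamespace false -- mandated namespace of this single-conjunct summit

open CategoryTheory AlgebraicGeometry TopologicalSpace Topology

namespace Summit.ResolutionOfSingularities.ResolutionOfSingularities.Theorems

namespace CampaignW42

open Literature.AlgebraicGeometry.Resolution Literature.RingTheory.HilbertSamuel
open Summit.ResolutionOfSingularities.ResolutionOfSingularities.Theorems.SigmaMaxModificationsCorridor3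

universe u

variable {p : ℕ} {R : ∀ S : Scheme.{u}, CentreSeq S → Prop} {N : ℕ} {ν : ℕ → ℕ}

/-! ## 1. The liveness dichotomy for `S(X, ν)` -/

/-- **LIVE AND NOT INFINITE ⇒ TERMINATES.** If every canonical run of `S(X, ν)` whose last stage still has a
non-empty `ν`-stratum is prolonged by a canonical run one step longer («live»: the oracle answers and the replayed
strict transform embeds), and `S(X, ν)` has no runs of every length, then some canonical run ends with an empty
`ν`-stratum — «there is an `n_r` such that `Y_{n_r}` is empty» (CJS Rem. 6.29 (1)). Any oracle. [folklore] -/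
theorem canonicalSequenceTerminates_of_live_of_not_infinite {X : Scheme.{u}}
    (hlive : ∀ s : CentreSeq X, s.IsCanonicalRun R N ν → (Scheme.hsStratum s.top N ν).Nonempty →
      ∃ s' : CentreSeq X, s'.IsCanonicalRun R N ν ∧ s'.length = s.length + 1)
    (hinf : ¬ CanonicalSequenceInfinite R N ν X) : CanonicalSequenceTerminates R N ν X := by
  classical
  have hex : ∃ n, ¬ ∃ s : CentreSeq X, s.IsCanonicalRun R N ν ∧ s.length = n := not_forall.mp hinf
  have hn₀ : ¬ ∃ s : CentreSeq X, s.IsCanonicalRun R N ν ∧ s.length = Nat.find hex := Nat.find_spec hex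
  have hpos : Nat.find hex ≠ 0 := by
    intro h0
    exact hn₀ ⟨CentreSeq.nil X, CentreSeq.isCanonicalRun_nil X, by rw [h0]; rfl⟩
  obtain ⟨m, hm⟩ := Nat.exists_eq_succ_of_ne_zero hpos
  have hm' : ∃ s : CentreSeq X, s.IsCanonicalRun R N ν ∧ s.length = m :=
    not_not.mp (Nat.find_min hex (show m < Nat.find hex by omega))
  obtain ⟨s, hs, hlen⟩ := hm'
  by_cases hY : (Scheme.hsStratum s.top N ν).Nonempty
  · obtain ⟨s', hs', hlen'⟩ := hlive s hs hY
    exact absurd ⟨s', hs', by rw [hlen', hlen, hm]⟩ hn₀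
  · exact ⟨s, hs, Set.not_nonempty_iff_eq_empty.mp hY⟩

/-- **THE TRICHOTOMY: `S(X, ν)` terminates, or is infinite, or is stuck** (a canonical run with non-empty last
`ν`-stratum that no canonical run prolongs). Any oracle; for a functional oracle the three cases are moreover
mutually exclusive (`CanonicalSequenceTerminates.not_infinite`, uniqueness of runs of each length). [folklore] -/
theorem canonicalSequence_trichotomy (X : Scheme.{u}) :
    CanonicalSequenceTerminates R N ν X ∨ CanonicalSequenceInfinite R N ν X ∨
      ∃ s : CentreSeq X, s.IsCanonicalRun R N ν ∧ (Scheme.hsStratum s.top N ν).Nonempty ∧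
        ¬ ∃ s' : CentreSeq X, s'.IsCanonicalRun R N ν ∧ s'.length = s.length + 1 := by
  by_cases hinf : CanonicalSequenceInfinite R N ν X
  · exact Or.inr (Or.inl hinf)
  by_cases hstuck : ∃ s : CentreSeq X, s.IsCanonicalRun R N ν ∧ (Scheme.hsStratum s.top N ν).Nonempty ∧
      ¬ ∃ s' : CentreSeq X, s'.IsCanonicalRun R N ν ∧ s'.length = s.length + 1
  · exact Or.inr (Or.inr hstuck)
  refine Or.inl (canonicalSequenceTerminates_of_live_of_not_infinite (fun s hs hY => ?_) hinf)
  by_contra h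
  exact hstuck ⟨s, hs, hY, h⟩

/-- Initial segments of a canonical run from a state are canonical runs from that state, of every length up to the
run's. [folklore] -/
theorem exists_isCanonicalRunFrom_prefix :
    ∀ {W : Scheme.{u}} {L : Labelling W} {P : Option (Pending W)} {t : CentreSeq W},
      IsCanonicalRunFrom R N ν L P t → ∀ n, n ≤ t.length →
        ∃ s : CentreSeq W, IsCanonicalRunFrom R N ν L P s ∧ s.length = n
  | W, L, P, CentreSeq.nil _, _, n, hn => ⟨CentreSeq.nil W, trivial, by
      rw [CentreSeq.length_nil] at hn ⊢
      exact (Nat.le_zero.mp hn).symm⟩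
  | W, L, P, CentreSeq.cons C rest, ht, 0, _ => ⟨CentreSeq.nil W, trivial, rfl⟩
  | W, L, P, CentreSeq.cons C rest, ht, n + 1, hn => by
    obtain ⟨P', hst, hrest⟩ := ht
    obtain ⟨s, hs, hlen⟩ := exists_isCanonicalRunFrom_prefix hrest n (by simpa using hn)
    exact ⟨CentreSeq.cons C s, ⟨P', hst, hs⟩, by simp [hlen]⟩

/-- For a functional oracle a STUCK `S(X, ν)` neither terminates nor is infinite: the stuck run is the unique run of
its length, a terminating run is no longer than it and cannot be prolonged past an empty stratum either.
[folklore] -/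
theorem not_terminates_and_not_infinite_of_stuck (hRf : OracleFunctional R) {X : Scheme.{u}} {s : CentreSeq X}
    (hs : s.IsCanonicalRun R N ν) (hY : (Scheme.hsStratum s.top N ν).Nonempty)
    (hstuck : ¬ ∃ s' : CentreSeq X, s'.IsCanonicalRun R N ν ∧ s'.length = s.length + 1) :
    ¬ CanonicalSequenceTerminates R N ν X ∧ ¬ CanonicalSequenceInfinite R N ν X := by
  refine ⟨?_, fun hinf => hstuck (hinf (s.length + 1))⟩
  rintro ⟨t, ht, htY⟩
  have hle : s.length ≤ t.length := IsCanonicalRunFrom.length_le_of_hsStratum_top_eq_empty hRf ht htY hs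
  rcases hle.eq_or_lt with heq | hlt
  · obtain rfl : s = t := CentreSeq.IsCanonicalRun.eq_of_length_eq hRf hs ht heq
    rw [htY] at hY
    exact Set.not_nonempty_empty hY
  · -- `t` is longer than `s`: its initial segment of length `s.length + 1` prolongs `s`
    exact hstuck (exists_isCanonicalRunFrom_prefix ht (s.length + 1) (by omega))

/-! ## 2. Chains from the initial marked stage; closing the bracket -/

/-- A chain of canonical near steps whose first term is REACHED from `s₀` can be re-indexed to START at `s₀`
(prefix the finite path). [folklore] -/
theorem exists_chain_eq_of_reaches {s₀ : MarkedStage.{u}} {c : ℕ → MarkedStage.{u}}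
    (h0 : Reaches R N ν s₀ (c 0)) (hstep : ∀ n, CanonicalNearStep R N ν (c n) (c (n + 1))) :
    ∃ c' : ℕ → MarkedStage.{u}, c' 0 = s₀ ∧ ∀ n, CanonicalNearStep R N ν (c' n) (c' (n + 1)) := by
  induction h0 using Relation.ReflTransGen.head_induction_on with
  | refl => exact ⟨c, rfl, hstep⟩
  | @head a b hab _ ih =>
    obtain ⟨c', hc'0, hc'⟩ := ih
    refine ⟨fun n => Nat.rec a (fun m _ => c' m) n, rfl, fun n => ?_⟩
    cases n with
    | zero =>
      show CanonicalNearStep R N ν a (c' 0)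
      rw [hc'0]
      exact hab
    | succ n => exact hc' n

/-- The ungraded «no infinite near chain from the initial marked stage» in its two spellings: chains REACHED from
`MarkedStage.init X x` (the OURS `NoNearChainFrom … ⊤`) versus chains STARTING there. [folklore] -/
theorem noNearChainFrom_init_top_iff {X : Scheme.{u}} [IsLocallyNoetherian X] {x : X} :
    NoNearChainFrom R N ν (MarkedStage.init X x) (fun _ => True) ↔
      ¬ ∃ c : ℕ → MarkedStage.{u}, c 0 = MarkedStage.init X x ∧
        ∀ n, CanonicalNearStep R N ν (c n) (c (n + 1)) := by
  constructor
  · rintro h ⟨c, hc0, hstep⟩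
    exact h ⟨c, hc0 ▸ Relation.ReflTransGen.refl, hstep, fun _ => trivial⟩
  · rintro h ⟨c, h0, hstep, -⟩
    obtain ⟨c', hc'0, hc'⟩ := exists_chain_eq_of_reaches h0 hstep
    exact h ⟨c', hc'0, hc'⟩

/-- **TERMINATION OF `S(X, ν)` ⇒ NO INFINITE NEAR CHAIN FROM THE INITIAL MARKED STAGE** (functional oracle; the
Reduction file's `noNearChain_init_of_terminates` in `NoNearChainFrom` form). [folklore] -/
theorem noNearChainFrom_init_of_canonicalSequenceTerminates (hRf : OracleFunctional R) {X : Scheme.{u}}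
    [IsLocallyNoetherian X] {x : X} (hterm : CanonicalSequenceTerminates R N ν X) :
    NoNearChainFrom R N ν (MarkedStage.init X x) fun _ => True := by
  rw [noNearChainFrom_init_top_iff]
  rintro ⟨c, hc0, hstep⟩
  exact noNearChain_init_of_terminates hRf hterm (fun _ => True) ⟨c, hc0, hstep, fun _ => trivial⟩

/-- **NO INFINITE NEAR CHAIN ⇒ `S(X, ν)` TERMINATES** at an isolated origin, for a functional oracle with permissible
canonical centres (CJS Lemma 5.34 (3) in the source's setting) that is LIVE along `S(X, ν)`: compactness
(`not_canonicalSequenceInfinite_of_noNearChain`, p478155) excludes the infinite case, liveness the stuck one.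
[cite: CossartJannsenSaito2020, Rem. 6.29 (1), p. 107] -/
theorem canonicalSequenceTerminates_of_noNearChain (hRf : OracleFunctional R) {X : Scheme.{u}}
    [IsLocallyNoetherian X] {x : X} (hX : IsIsolatedOrigin p N ν X x)
    (hperm : ∀ t : CentreSeq X, t.IsCanonicalRun R N ν → t.AllPermissible)
    (hlive : ∀ s : CentreSeq X, s.IsCanonicalRun R N ν → (Scheme.hsStratum s.top N ν).Nonempty →
      ∃ s' : CentreSeq X, s'.IsCanonicalRun R N ν ∧ s'.length = s.length + 1)
    (h : NoNearChainFrom R N ν (MarkedStage.init X x) fun _ => True) : CanonicalSequenceTerminates R N ν X :=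
  canonicalSequenceTerminates_of_live_of_not_infinite hlive
    (not_canonicalSequenceInfinite_of_noNearChain hRf hX hperm h)

/-- **THE BRACKET CLOSES: at an isolated origin, the ungraded O2 statement IS the termination of `S(X, ν)`** —
`NoNearChainFrom R N ν (MarkedStage.init X x) ⊤ ↔ CanonicalSequenceTerminates R N ν X` — for a functional oracle with
permissible canonical centres that is live along `S(X, ν)` (CJS Rem. 6.29 (1) «this procedure ends … which is a
non-trivial fact» ⟷ p. 107 «no infinite sequence of closed points x_n ∈ X_n(ν̃) … x_{n+1} lies above x_n»).
[cite: CossartJannsenSaito2020, Rem. 6.29 (1), p. 107] -/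
theorem noNearChain_init_iff_canonicalSequenceTerminates (hRf : OracleFunctional R) {X : Scheme.{u}}
    [IsLocallyNoetherian X] {x : X} (hX : IsIsolatedOrigin p N ν X x)
    (hperm : ∀ t : CentreSeq X, t.IsCanonicalRun R N ν → t.AllPermissible)
    (hlive : ∀ s : CentreSeq X, s.IsCanonicalRun R N ν → (Scheme.hsStratum s.top N ν).Nonempty →
      ∃ s' : CentreSeq X, s'.IsCanonicalRun R N ν ∧ s'.length = s.length + 1) :
    (NoNearChainFrom R N ν (MarkedStage.init X x) fun _ => True) ↔ CanonicalSequenceTerminates R N ν X :=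
  ⟨canonicalSequenceTerminates_of_noNearChain hRf hX hperm hlive,
    noNearChainFrom_init_of_canonicalSequenceTerminates hRf⟩

/-- **`TertiaryTermination p` ⇒ `S(X, ν)` TERMINATES at every isolated origin of characteristic `p`**, for every
functional admissible oracle with permissible canonical centres that is live there. [cite: CossartJannsenSaito2020, Rem. 6.29 (1)] -/
theorem canonicalSequenceTerminates_of_tertiaryTermination (h : TertiaryTermination.{u} p)
    (hRf : OracleFunctional R) (hRa : OracleAdmissible R) {X : Scheme.{u}} [IsLocallyNoetherian X] {x : X}
    (hX : IsIsolatedOrigin p N ν X x) (hperm : ∀ t : CentreSeq X, t.IsCanonicalRun R N ν → t.AllPermissible)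
    (hlive : ∀ s : CentreSeq X, s.IsCanonicalRun R N ν → (Scheme.hsStratum s.top N ν).Nonempty →
      ∃ s' : CentreSeq X, s'.IsCanonicalRun R N ν ∧ s'.length = s.length + 1) :
    CanonicalSequenceTerminates R N ν X :=
  canonicalSequenceTerminates_of_noNearChain hRf hX hperm hlive (h R hRf hRa N ν X x hX)

/-! ## 3. The terminating canonical run is a `ν`-elimination -/

/-- **A TERMINATING `S(X, ν)` WITH PERMISSIBLE CENTRES IN THE STRATA IS A `ν`-ELIMINATION** (CJS Def. 6.14; tree
`IsCanonicalEliminationSequence.isNuElimination`): the whole canonical run is a blow-up sequence in permissible centres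
`D_i ⊆ X_i(ν)` ending with `X_n(ν) = ∅`. [cite: CossartJannsenSaito2020, Def. 6.14, Rem. 6.29 (1)] -/
theorem exists_isNuElimination_of_canonicalSequenceTerminates {X : Scheme.{u}}
    (hterm : CanonicalSequenceTerminates R N ν X)
    (hcent : ∀ t : CentreSeq X, t.IsCanonicalRun R N ν → t.AllPermissible ∧ t.CentresInStratum N ν) :
    ∃ s : CentreSeq X, s.IsCanonicalRun R N ν ∧ s.IsNuElimination N ν := by
  obtain ⟨s, hs⟩ := hterm
  exact ⟨s, hs.1, hs.isNuElimination (hcent s hs.1).1 (hcent s hs.1).2⟩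

/-- **REGULAR CENTRES IN THE STRATA SUFFICE** on a reduced excellent `X` with `dim X ≤ N` and `ν ≠ Φ^{(N)}` (tree,
res-L1-w42-stub-3: `CentreSeq.allPermissible_of_allRegular_of_centresInStratum`, CJS Thm. 3.3 / Def. 3.1 (2) along the
sequence): canonical runs with regular centres inside the successive `ν`-strata have permissible centres there.
This is the form in which CJS establish it in dimension two (p. 92: the replayed centres are those of the canonical
resolution sequence of `Y_r^{(j)}`, regular, inside `Y_{j,i} = Y_i^{(j)} ⊆ X_i(ν)`; the cycle-ending centre is the
regular `Y_{m}^{(j)}` itself). [cite: CossartJannsenSaito2020, Thm. 3.3, Rem. 6.29 (1), p. 92] -/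
theorem canonicalCentres_permissible_of_regular {X : Scheme.{u}} [IsLocallyNoetherian X] [IsReduced X]
    (hexc : Scheme.IsExcellent X) (hdim : topologicalKrullDim X ≤ (N : WithBot ℕ∞)) (hν : ν ≠ iterPSum N Phi)
    (hcent : ∀ t : CentreSeq X, t.IsCanonicalRun R N ν → t.AllRegular ∧ t.CentresInStratum N ν)
    (t : CentreSeq X) (ht : t.IsCanonicalRun R N ν) : t.AllPermissible ∧ t.CentresInStratum N ν :=
  ⟨Helpers.CentreSeq.allPermissible_of_allRegular_of_centresInStratum t hexc hdim hν (hcent t ht).1 (hcent t ht).2,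
    (hcent t ht).2⟩

/-- **`TertiaryTermination p` ⇒ `S(X, ν)` IS A `ν`-ELIMINATION at every isolated origin of characteristic `p`**, for
every functional admissible oracle live there whose canonical centres are permissible and lie in the strata.
[cite: CossartJannsenSaito2020, Def. 6.14, Rem. 6.29 (1), p. 107] -/
theorem exists_isNuElimination_of_tertiaryTermination (h : TertiaryTermination.{u} p)
    (hRf : OracleFunctional R) (hRa : OracleAdmissible R) {X : Scheme.{u}} [IsLocallyNoetherian X] {x : X}
    (hX : IsIsolatedOrigin p N ν X x)
    (hcent : ∀ t : CentreSeq X, t.IsCanonicalRun R N ν → t.AllPermissible ∧ t.CentresInStratum N ν)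
    (hlive : ∀ s : CentreSeq X, s.IsCanonicalRun R N ν → (Scheme.hsStratum s.top N ν).Nonempty →
      ∃ s' : CentreSeq X, s'.IsCanonicalRun R N ν ∧ s'.length = s.length + 1) :
    ∃ s : CentreSeq X, s.IsCanonicalRun R N ν ∧ s.IsNuElimination N ν :=
  exists_isNuElimination_of_canonicalSequenceTerminates
    (canonicalSequenceTerminates_of_tertiaryTermination h hRf hRa hX (fun t ht => (hcent t ht).1) hlive) hcent

/-! ## 4. Hence a `ν`-modification (line tame_wild's `NuMod`) — what O2 buys for Corridor3 / DimGe4 -/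

/-- **ONE LIVE ADMISSIBLE FUNCTIONAL ORACLE WITHOUT INFINITE NEAR CHAINS GIVES A `ν`-MODIFICATION** of an isolated
maximal stratum (the existential-oracle form; universe `0`, where `TameWild.NuMod` lives): `X` reduced and of finite
type over a field of characteristic `p` (bundled in `IsIsolatedOrigin`), `dim X ≤ d`, `ν ∈ Σ_X(N)^max`, `X(ν) = {x}`
with `x` closed; the canonical centres permissible in the strata and `S(X, ν)` live. Then the canonical run is a
`ν`-elimination and `TameWild.nuMod_of_isNuElimination` (p460155; Bennett–Hironaka–Singh monotonicity PROVED in the tree)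
packages it. [cite: CossartJannsenSaito2020, Def. 6.14, Rem. 6.24, Thm. 3.10 (1)] -/
theorem nuMod_of_noNearChain {p : ℕ} {R : ∀ S : Scheme.{0}, CentreSeq S → Prop} {N : ℕ} {ν : ℕ → ℕ}
    (hRf : OracleFunctional R) {X : Scheme.{0}} [IsLocallyNoetherian X] {x : X} (hX : IsIsolatedOrigin p N ν X x)
    {d : ℕ} (hdimd : topologicalKrullDim X ≤ (d : WithBot ℕ∞))
    (hcent : ∀ t : CentreSeq X, t.IsCanonicalRun R N ν → t.AllPermissible ∧ t.CentresInStratum N ν)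
    (hlive : ∀ s : CentreSeq X, s.IsCanonicalRun R N ν → (Scheme.hsStratum s.top N ν).Nonempty →
      ∃ s' : CentreSeq X, s'.IsCanonicalRun R N ν ∧ s'.length = s.length + 1)
    (h : NoNearChainFrom R N ν (MarkedStage.init X x) fun _ => True) : TameWild.NuMod X N d ν := by
  obtain ⟨k, _, _, f, -, hft, -⟩ := hX.exists_structure
  haveI := hft
  haveI : IsReduced X := hX.isReduced
  obtain ⟨s, -, hs⟩ := exists_isNuElimination_of_canonicalSequenceTerminates
    (canonicalSequenceTerminates_of_noNearChain hRf hX (fun t ht => (hcent t ht).1) hlive h) hcent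
  exact TameWild.nuMod_of_isNuElimination f hdimd hX.dim_le hX.maximal s hs

/-- **WHAT O2 BUYS — `TertiaryTermination p ⇒ ν-MODIFICATION OF EVERY ISOLATED MAXIMAL STRATUM` in characteristic
`p`, in every dimension** (calibration against Corridor3, stmt-…-19249, whose confined open core
`stub_confinedWildNu3` wants «a termination argument at finitely many closed points with `e_x = 3`», and against the
residual `SigmaMaxModificationsDimGe4`, stmt-…-19250): for `X` reduced of finite type over a field of characteristic
`p`, `dim X ≤ d`, `dim X ≤ N`, `ν` maximal, `X(ν) = {x}` closed, and ANY functional admissible oracle `R` live along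
`S(X, ν)` with permissible canonical centres in the strata, `TameWild.NuMod X N d ν`. Inputs beyond O2, verbatim:
liveness of `S` for that oracle (lower-dimensional resolution + GW 13.96 (2)) and «Y_{0,i} = Y_i^{(0)}» (CJS p. 92).
[cite: CossartJannsenSaito2020, Def. 6.14, Rem. 6.29 (1), p. 92, p. 107] -/
theorem nuMod_of_tertiaryTermination {p : ℕ} (h : TertiaryTermination.{0} p)
    {R : ∀ S : Scheme.{0}, CentreSeq S → Prop} {N : ℕ} {ν : ℕ → ℕ} (hRf : OracleFunctional R)
    (hRa : OracleAdmissible R) {X : Scheme.{0}} [IsLocallyNoetherian X] {x : X} (hX : IsIsolatedOrigin p N ν X x)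
    {d : ℕ} (hdimd : topologicalKrullDim X ≤ (d : WithBot ℕ∞))
    (hcent : ∀ t : CentreSeq X, t.IsCanonicalRun R N ν → t.AllPermissible ∧ t.CentresInStratum N ν)
    (hlive : ∀ s : CentreSeq X, s.IsCanonicalRun R N ν → (Scheme.hsStratum s.top N ν).Nonempty →
      ∃ s' : CentreSeq X, s'.IsCanonicalRun R N ν ∧ s'.length = s.length + 1) :
    TameWild.NuMod X N d ν :=
  nuMod_of_noNearChain hRf hX hdimd hcent hlive (h R hRf hRa N ν X x hX)

/-- **The same with REGULAR centres in the strata** (and `ν ≠ Φ^{(N)}`, the shape of every Corridor3 stub): finite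
type over a field makes `X` excellent (Stacks 07QW, tree `Stacks07QW_field_holds`), so
`canonicalCentres_permissible_of_regular` applies. [cite: CossartJannsenSaito2020, Def. 6.14, Thm. 3.3, Rem. 6.29 (1)] -/
theorem nuMod_of_tertiaryTermination_of_regular {p : ℕ} (h : TertiaryTermination.{0} p)
    {R : ∀ S : Scheme.{0}, CentreSeq S → Prop} {N : ℕ} {ν : ℕ → ℕ} (hRf : OracleFunctional R)
    (hRa : OracleAdmissible R) {X : Scheme.{0}} [IsLocallyNoetherian X] {x : X} (hX : IsIsolatedOrigin p N ν X x)
    {d : ℕ} (hdimd : topologicalKrullDim X ≤ (d : WithBot ℕ∞)) (hν : ν ≠ iterPSum N Phi)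
    (hcent : ∀ t : CentreSeq X, t.IsCanonicalRun R N ν → t.AllRegular ∧ t.CentresInStratum N ν)
    (hlive : ∀ s : CentreSeq X, s.IsCanonicalRun R N ν → (Scheme.hsStratum s.top N ν).Nonempty →
      ∃ s' : CentreSeq X, s'.IsCanonicalRun R N ν ∧ s'.length = s.length + 1) :
    TameWild.NuMod X N d ν := by
  obtain ⟨k, _, _, f, -, hft, -⟩ := hX.exists_structure
  haveI := hft
  haveI : IsReduced X := hX.isReduced
  have hexc : Scheme.IsExcellent X := Scheme.isExcellent_of_locallyOfFiniteType Stacks07QW_field_holds f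
  exact nuMod_of_tertiaryTermination h hRf hRa hX hdimd
    (canonicalCentres_permissible_of_regular hexc hX.dim_le hν hcent) hlive

end CampaignW42

end Summit.ResolutionOfSingularities.ResolutionOfSingularities.Theorems

end
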